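import Summits.Ventures.CertifiedArithmetic.Expansions.WeakExpansionClosure
import Summits.Ventures.CertifiedArithmetic.Expansions.WeakExpansionSum
import Literature.ComputerArithmetic.Shewchuk1997.TwoDiff
import Literature.ComputerArithmetic.Shewchuk1997.ScaleExpansion
import Literature.ComputerArithmetic.JoldesMullerPopescu2017.DWPlusFP
import Mathlib.Tactic.Linarith
import Mathlib.Tactic.Positivity
import Mathlib.Tactic.Ring
import Mathlib.Tactic.NormNum

/-!
# Building blocks for the exact stage of ORIENT2D: zero elimination, TWO-TWO-DIFF blocks, exact two-products

New work of this development (no published counterpart is claimed), the first half of the ORIENT2D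
formalisation whose statement and overview are in `Orient2d.lean`.  Contents:
* small format facts (`isFloat_of_emin_le`, `isFloat_of_isFloat_of_onGrid`), closure of the class `W`
  of weakly nonoverlapping expansions under componentwise negation (`isWeakExpansion_map_neg`), the
  two-component W-expansion produced by any error-free transformation (`isWeakExpansion_pair_of_exact`);
* ZERO ELIMINATION `zeroElim` [Shewchuk1997, §2.4 p. 324–325] as performed by `predicates.c`'s
  `fast_expansion_sum_zeroelim` on its output, and `fastExpansionSumZeroElim_spec`: FAST-EXPANSION-SUM
  with zero elimination maps W-expansions of floats (`p ≥ 4`, `RoundoffBelow 2` rounding) to NONEMPTY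
  W-expansions of floats with the exact sum, zero-free unless equal to `⟨0⟩` (Theorems 1–2 of this
  development, `WeakExpansionClosure.lean`, plus zero elimination);
* `ExactTwoProd` ("the two-product routine `tp` is error-free at `(a, b)`") with its two instances
  absent underflow — the FMA two-product (`exactTwoProd_twoProdFMA`, [BoldoEtAl2023] Algorithm 3) and
  Dekker's / Shewchuk's TWO-PRODUCT (`exactTwoProd_twoProduct`, Theorem 18 as in `ScaleExpansion.lean`);
* TWO-TWO-DIFF as EXPANSION-SUM(⟨a₀, a₁⟩, ⟨−b₀, −b₁⟩) (`twoTwoDiff`), the check that `predicates.c`'s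
  macro `Two_Two_Diff` computes the same four numbers on floats (`twoTwoDiffMacro_eq`), and THE BLOCK
  LEMMA `twoTwoProdDiff_spec`: `TWO-TWO-DIFF(TWO-PRODUCT(a, b), TWO-PRODUCT(c, d))` is a four-component
  W-expansion of floats with sum `ab − cd` exactly (Theorem 5, `expansionSum_isWeakExpansion`).

MODELLING CAVEATS: see `Orient2d.lean` (zero elimination as a post-pass storing the same numbers; the
tree's merge order on equal magnitudes; TWO-DIFF needs a rounding commuting with negation).
-/

namespace Summit.Ventures.CertifiedArithmetic.Expansions

open Literature.ComputerArithmetic.JeannerodRump2018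
open Literature.ComputerArithmetic.BoldoJeannerodMelquiondMuller2023 hiding twoSum twoSum_fst isFloat_twoSum
open Literature.ComputerArithmetic.Shewchuk1997

variable {p : ℕ} {emin : ℤ} {fl : ℚ → ℚ}

/-! ## Small facts: formats, negation, pairs -/

/-- A float of a format with a higher underflow threshold `e₀ ≥ emin` is a float. -/
theorem isFloat_of_emin_le {e₀ : ℤ} (he : emin ≤ e₀) {x : ℚ} (h : IsFloat p e₀ x) :
    IsFloat p emin x := by
  obtain ⟨M, e, hM, he', rfl⟩ := h
  exact ⟨M, e, hM, he.trans he', rfl⟩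

/-- A `p`-bit float that is a multiple of `2^s` is a `p`-bit float of the format with underflow
threshold `s`. -/
theorem isFloat_of_isFloat_of_onGrid {x : ℚ} (hx : IsFloat p emin x) {s : ℤ} (hs : OnGrid s x) :
    IsFloat p s x := by
  obtain ⟨M, e, hM, -, rfl⟩ := hx
  obtain ⟨r, hr⟩ := hs
  by_cases hse : s ≤ e
  · exact ⟨M, e, hM, hse, rfl⟩
  · have hlt : e < s := not_le.mp hse
    refine ⟨r, s, ?_, le_rfl, hr⟩
    have h2e : (0 : ℚ) < (2 : ℚ) ^ e := zpow_pos (by norm_num) _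
    have hM' : (M : ℚ) = r * (2 : ℚ) ^ (s - e) := by
      rw [zpow_sub₀ (by norm_num : (2 : ℚ) ≠ 0), ← mul_div_assoc, eq_div_iff h2e.ne']
      exact hr
    obtain ⟨n, hn⟩ := Int.eq_ofNat_of_zero_le (sub_nonneg.mpr hlt.le)
    rw [hn, zpow_natCast] at hM'
    have hMi : M = r * 2 ^ n := by exact_mod_cast hM'
    have hle : |r| ≤ |M| := by
      rw [hMi, abs_mul, abs_of_pos (pow_pos (by norm_num : (0 : ℤ) < 2) n)]
      exact le_mul_of_one_le_right (abs_nonneg r) (one_le_pow₀ (by norm_num))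
    exact lt_of_le_of_lt hle hM

/-- `Below c` is invariant under negating both components. -/
theorem below_neg {c x y : ℚ} (h : Below c x y) : Below c (-x) (-y) := by
  obtain ⟨s, hs, hx⟩ := h
  exact ⟨s, hs.neg, by rwa [abs_neg]⟩

/-- `WeakBelow` is invariant under negating both components. -/
theorem weakBelow_neg {x y : ℚ} (h : WeakBelow x y) : WeakBelow (-x) (-y) :=
  h.imp below_neg fun ⟨h1, a, ha⟩ => ⟨below_neg h1, a, by rw [abs_neg, ha]⟩

/-- `NoDouble` is invariant under negation. -/
theorem noDouble_neg {x y z : ℚ} (h : NoDouble x y z) : NoDouble (-x) (-y) (-z) :=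
  h.imp below_neg below_neg

/-- The class `W` is closed under componentwise negation (so an expansion DIFFERENCE is an expansion
sum with the negated second operand). -/
theorem isWeakExpansion_map_neg {l : List ℚ} (h : IsWeakExpansion l) :
    IsWeakExpansion (l.map fun x => -x) :=
  ⟨h.1.map _ fun _ _ => weakBelow_neg, h.2.map fun hx => noDouble_neg hx⟩

/-- Membership in a two-element list. -/
theorem forall_mem_pair {P : ℚ → Prop} {a b : ℚ} (ha : P a) (hb : P b) : ∀ x ∈ [a, b], P x := by
  intro x hx
  simp only [List.mem_cons, List.not_mem_nil, or_false] at hx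
  rcases hx with rfl | rfl
  · exact ha
  · exact hb

/-- An error-free transformation `hi = fl t`, `hi + lo = t` of a rounding with `RoundoffBelow 2`
yields the two-component W-expansion `⟨lo, hi⟩` (indeed a nonadjacent one). -/
theorem isWeakExpansion_pair_of_exact (hfl2 : RoundoffBelow 2 fl) {t lo hi : ℚ} (hhi : hi = fl t)
    (hsum : hi + lo = t) : IsWeakExpansion [lo, hi] := by
  have hlo : lo = t - fl t := by rw [← hhi]; linarith
  have hb : Below 2 lo hi := by rw [hlo, hhi]; exact hfl2 t
  have h2 : IsExpansion 2 [lo, hi] := List.pairwise_pair.mpr hb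
  exact IsExpansion.isWeakExpansion_of_two h2

/-! ## Zero elimination -/

/-- **ZERO ELIMINATION** [Shewchuk1997, §2.4 p. 324–325] as performed by `predicates.c`'s
`fast_expansion_sum_zeroelim` on its output: keep the nonzero components (in order); if none is left,
return the one-component expansion `⟨0⟩` (the C code's final `if ((Q != 0.0) || (hindex == 0))
h[hindex++] = Q`). -/
def zeroElim (l : List ℚ) : List ℚ :=
  if l.filter (· ≠ 0) = [] then [0] else l.filter (· ≠ 0)

/-- Dropping zero components does not change the sum. -/
theorem sum_filter_ne_zero (l : List ℚ) : (l.filter (· ≠ 0)).sum = l.sum := by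
  induction l with
  | nil => rfl
  | cons x xs ih =>
    simp only [List.filter_cons]
    split_ifs with h
    · rw [List.sum_cons, List.sum_cons, ih]
    · have hx : x = 0 := by simpa using h
      rw [ih, List.sum_cons, hx, zero_add]

/-- The two shapes of a zero-eliminated list. -/
theorem zeroElim_cases (l : List ℚ) :
    (zeroElim l = [0] ∧ l.filter (· ≠ 0) = []) ∨
      (zeroElim l = l.filter (· ≠ 0) ∧ l.filter (· ≠ 0) ≠ []) := by
  unfold zeroElim
  split_ifs with h
  · exact Or.inl ⟨rfl, h⟩
  · exact Or.inr ⟨rfl, h⟩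

/-- A zero-eliminated list is never empty. -/
theorem zeroElim_ne_nil (l : List ℚ) : zeroElim l ≠ [] := by
  rcases zeroElim_cases l with ⟨h, -⟩ | ⟨h, hne⟩
  · rw [h]; exact List.cons_ne_nil _ _
  · rw [h]; exact hne

/-- Zero elimination preserves the sum. -/
theorem sum_zeroElim (l : List ℚ) : (zeroElim l).sum = l.sum := by
  rcases zeroElim_cases l with ⟨h, hf⟩ | ⟨h, -⟩
  · rw [h, ← sum_filter_ne_zero l, hf]; simp
  · rw [h, sum_filter_ne_zero]

/-- A component of a zero-eliminated list is a nonzero component of the list, or the lone `0`. -/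
theorem mem_zeroElim {l : List ℚ} {x : ℚ} (hx : x ∈ zeroElim l) : (x ∈ l ∧ x ≠ 0) ∨ x = 0 := by
  rcases zeroElim_cases l with ⟨h, -⟩ | ⟨h, -⟩ <;> rw [h] at hx
  · exact Or.inr (List.mem_singleton.mp hx)
  · have h' := List.mem_filter.mp hx
    exact Or.inl ⟨h'.1, by simpa using h'.2⟩

/-- Either every component of `zeroElim l` is nonzero, or `zeroElim l = ⟨0⟩`. -/
theorem zeroElim_nonzero_or (l : List ℚ) : (∀ x ∈ zeroElim l, x ≠ 0) ∨ zeroElim l = [0] := by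
  rcases zeroElim_cases l with ⟨h, -⟩ | ⟨h, -⟩
  · exact Or.inr h
  · left
    rw [h]
    intro x hx
    have h' := (List.mem_filter.mp hx).2
    simpa using h'

/-- Zero elimination does not lengthen a nonempty list. -/
theorem length_zeroElim_le (l : List ℚ) : (zeroElim l).length ≤ max l.length 1 := by
  rcases zeroElim_cases l with ⟨h, -⟩ | ⟨h, -⟩ <;> rw [h]
  · simp
  · exact (List.length_filter_le _ _).trans (le_max_left _ _)

/-- Zero elimination keeps a weakly nonoverlapping expansion weakly nonoverlapping (a sublist, or
the singleton `⟨0⟩`). -/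
theorem isWeakExpansion_zeroElim {l : List ℚ} (h : IsWeakExpansion l) :
    IsWeakExpansion (zeroElim l) := by
  rcases zeroElim_cases l with ⟨h', -⟩ | ⟨h', -⟩ <;> rw [h']
  · exact ⟨List.pairwise_singleton _ _, List.triplewise_singleton _ _⟩
  · exact h.sublist List.filter_sublist

/-- **FAST-EXPANSION-SUM WITH ZERO ELIMINATION** (`fast_expansion_sum_zeroelim` of `predicates.c`),
modelled as the tree's FAST-EXPANSION-SUM followed by `zeroElim` (see the module docstring, caveats
(1)–(2)). -/
def fastExpansionSumZeroElim (fl : ℚ → ℚ) (e f : List ℚ) : List ℚ :=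
  zeroElim (fastExpansionSum fl e f)

/-- FESZE maps two W-expansions of floats (`p ≥ 4`, `RoundoffBelow 2` rounding) to a NONEMPTY
W-expansion of floats with the exact sum, whose components are all nonzero unless it is `⟨0⟩`, of
length `≤ max (m + n) 1` — Theorems 1 and 2 of this development plus zero elimination. -/
theorem fastExpansionSumZeroElim_spec (hp : 4 ≤ p) (hfl : IsRoundNearest p emin fl)
    (hfl2 : RoundoffBelow 2 fl) {e f : List ℚ}
    (heF : ∀ x ∈ e, IsFloat p emin x) (hes : IsWeakExpansion e)
    (hfF : ∀ x ∈ f, IsFloat p emin x) (hfs : IsWeakExpansion f) :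
    IsWeakExpansion (fastExpansionSumZeroElim fl e f) ∧
      (fastExpansionSumZeroElim fl e f).sum = e.sum + f.sum ∧
      (∀ x ∈ fastExpansionSumZeroElim fl e f, IsFloat p emin x) ∧
      fastExpansionSumZeroElim fl e f ≠ [] ∧
      ((∀ x ∈ fastExpansionSumZeroElim fl e f, x ≠ 0) ∨ fastExpansionSumZeroElim fl e f = [0]) ∧
      (fastExpansionSumZeroElim fl e f).length ≤ max (e.length + f.length) 1 := by
  have hW := fastExpansionSum_isWeakExpansion hp hfl hfl2 heF hes hfF hfs
  obtain ⟨-, hS, hL, hF⟩ := fastExpansionSum_nonoverlapping_of_isWeakExpansion hp hfl heF hes hfF hfs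
  unfold fastExpansionSumZeroElim
  refine ⟨isWeakExpansion_zeroElim hW, by rw [sum_zeroElim, hS], fun x hx => ?_, zeroElim_ne_nil _,
    zeroElim_nonzero_or _, by rw [← hL]; exact length_zeroElim_le _⟩
  rcases mem_zeroElim hx with ⟨hx, -⟩ | rfl
  · exact hF x hx
  · exact isFloat_zero p emin

/-! ## Exact two-products and the TWO-TWO-DIFF block -/

/-- "`tp` is an ERROR-FREE TWO-PRODUCT at `(a, b)`": it returns `x = a ⊗ b` and a float `y` with
`x + y = ab`.  Instances: the FMA two-product (`exactTwoProd_twoProdFMA`) and Dekker's / Shewchuk's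
TWO-PRODUCT (`exactTwoProd_twoProduct`), each absent underflow. -/
def ExactTwoProd (p : ℕ) (emin : ℤ) (fl : ℚ → ℚ) (tp : ℚ → ℚ → ℚ × ℚ) (a b : ℚ) : Prop :=
  (tp a b).1 = fl (a * b) ∧ (tp a b).1 + (tp a b).2 = a * b ∧ IsFloat p emin (tp a b).2

/-- **TWO-TWO-DIFF** `(a₁ + a₀) − (b₁ + b₀)` as a four-component expansion, smallest first:
EXPANSION-SUM of `⟨a₀, a₁⟩` and `⟨−b₀, −b₁⟩` [Shewchuk1997, §2.4 Fig. 7; §2.8 "EXPANSION-DIFF"]. -/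
def twoTwoDiff (fl : ℚ → ℚ) (a₁ a₀ b₁ b₀ : ℚ) : List ℚ :=
  expansionSum fl [a₀, a₁] [-b₀, -b₁]

/-- `predicates.c`'s macro `Two_One_Diff(a1, a0, b; x2, x1, x0)`:
`Two_Diff(a0, b, _i, x0); Two_Sum(a1, _i, x2, x1)`; returned as `(x2, x1, x0)`. -/
def twoOneDiff (fl : ℚ → ℚ) (a₁ a₀ b : ℚ) : ℚ × ℚ × ℚ :=
  ((twoSum fl a₁ (twoDiff fl a₀ b).1).1, (twoSum fl a₁ (twoDiff fl a₀ b).1).2, (twoDiff fl a₀ b).2)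

/-- `predicates.c`'s macro `Two_Two_Diff(a1, a0, b1, b0; x3, x2, x1, x0)`:
`Two_One_Diff(a1, a0, b0, _j, _0, x0); Two_One_Diff(_j, _0, b1, x3, x2, x1)`; listed smallest first
as `⟨x0, x1, x2, x3⟩`. -/
def twoTwoDiffMacro (fl : ℚ → ℚ) (a₁ a₀ b₁ b₀ : ℚ) : List ℚ :=
  let r := twoOneDiff fl a₁ a₀ b₀
  let s := twoOneDiff fl r.1 r.2.1 b₁
  [r.2.2, s.2.2, s.2.1, s.1]

/-- For float operands and a rounding commuting with negation, the macro `Two_Two_Diff` computes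
exactly the four numbers of `twoTwoDiff` = EXPANSION-SUM(⟨a₀, a₁⟩, ⟨−b₀, −b₁⟩) (TWO-DIFF(u, v) =
TWO-SUM(u, −v) = TWO-SUM(−v, u) on floats: `twoDiff_eq_twoSum_neg`, and the symmetry of 2Sum's output on
floats, `JoldesMullerPopescu2017.twoSum_comm`, transported along `twoSum_eq_twoSum_swap`). -/
theorem twoTwoDiffMacro_eq (hp : 1 ≤ p) (hfl : IsRoundNearest p emin fl)
    (hodd : ∀ t, fl (-t) = -fl t) {a₁ a₀ b₁ b₀ : ℚ} (ha₁ : IsFloat p emin a₁)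
    (ha₀ : IsFloat p emin a₀) (hb₁ : IsFloat p emin b₁) (hb₀ : IsFloat p emin b₀) :
    twoTwoDiffMacro fl a₁ a₀ b₁ b₀ = twoTwoDiff fl a₁ a₀ b₁ b₀ := by
  -- TWO-SUM(u, v) = TWO-SUM(v, u) for floats (both pairs are `(fl (u + v), exact roundoff)`)
  have swap : ∀ {u v : ℚ}, IsFloat p emin u → IsFloat p emin v → twoSum fl u v = twoSum fl v u :=
    fun hu hv => by
      rw [twoSum_eq_twoSum_swap, twoSum_eq_twoSum_swap]
      exact (Literature.ComputerArithmetic.JoldesMullerPopescu2017.twoSum_comm hp hfl hu hv).symm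
  have hQ := isFloat_twoSum hfl (-b₀) a₀
  have e1 : twoDiff fl a₀ b₀ = twoSum fl (-b₀) a₀ := by
    rw [twoDiff_eq_twoSum_neg hodd, swap ha₀ hb₀.neg]
  have e2 : twoSum fl a₁ (twoSum fl (-b₀) a₀).1 = twoSum fl (twoSum fl (-b₀) a₀).1 a₁ :=
    swap ha₁ hQ.1
  have hy := isFloat_twoSum hfl (twoSum fl (-b₀) a₀).1 a₁
  have e3 : twoDiff fl (twoSum fl (twoSum fl (-b₀) a₀).1 a₁).2 b₁ =
      twoSum fl (-b₁) (twoSum fl (twoSum fl (-b₀) a₀).1 a₁).2 := by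
    rw [twoDiff_eq_twoSum_neg hodd, swap hy.2 hb₁.neg]
  have hS := isFloat_twoSum hfl (-b₁) (twoSum fl (twoSum fl (-b₀) a₀).1 a₁).2
  have e4 : twoSum fl (twoSum fl (twoSum fl (-b₀) a₀).1 a₁).1
      (twoSum fl (-b₁) (twoSum fl (twoSum fl (-b₀) a₀).1 a₁).2).1 =
      twoSum fl (twoSum fl (-b₁) (twoSum fl (twoSum fl (-b₀) a₀).1 a₁).2).1
        (twoSum fl (twoSum fl (-b₀) a₀).1 a₁).1 :=
    swap hy.1 hS.1
  simp only [twoTwoDiffMacro, twoOneDiff, twoTwoDiff, expansionSum_cons_cons, growExpansion_cons,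
    growExpansion_nil, expansionSum_nil_right, e1, e2, e3, e4]

/-- The block `TWO-TWO-DIFF(TWO-PRODUCT(a, b), TWO-PRODUCT(c, d))` of `orient2dadapt`
(`Two_Product(acx, bcy, …); Two_Product(acy, bcx, …); Two_Two_Diff(…)`), over a two-product
routine `tp`. -/
def twoTwoProdDiff (tp : ℚ → ℚ → ℚ × ℚ) (fl : ℚ → ℚ) (a b c d : ℚ) : List ℚ :=
  twoTwoDiff fl (tp a b).1 (tp a b).2 (tp c d).1 (tp c d).2

/-- **THE BLOCK LEMMA.** If the two products are error-free, the block is a four-component weakly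
nonoverlapping expansion of floats with `Σ = ab − cd` EXACTLY (`p ≥ 1`, `RoundoffBelow 2` rounding):
the pairs `⟨lo, hi⟩` and `⟨−lo', −hi'⟩` are in `W` and EXPANSION-SUM preserves `W` (Theorem 5). -/
theorem twoTwoProdDiff_spec (hp : 1 ≤ p) (hfl : IsRoundNearest p emin fl) (hfl2 : RoundoffBelow 2 fl)
    {tp : ℚ → ℚ → ℚ × ℚ} {a b c d : ℚ} (hab : ExactTwoProd p emin fl tp a b)
    (hcd : ExactTwoProd p emin fl tp c d) :
    IsWeakExpansion (twoTwoProdDiff tp fl a b c d) ∧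
      (twoTwoProdDiff tp fl a b c d).sum = a * b - c * d ∧
      (twoTwoProdDiff tp fl a b c d).length = 4 ∧
      ∀ x ∈ twoTwoProdDiff tp fl a b c d, IsFloat p emin x := by
  obtain ⟨h1, hs1, hF1⟩ := hab
  obtain ⟨h2, hs2, hF2⟩ := hcd
  have hhi1 : IsFloat p emin (tp a b).1 := h1 ▸ (hfl _).1
  have hhi2 : IsFloat p emin (tp c d).1 := h2 ▸ (hfl _).1
  have he : ∀ x ∈ [(tp a b).2, (tp a b).1], IsFloat p emin x := forall_mem_pair hF1 hhi1
  have hf : ∀ x ∈ [-(tp c d).2, -(tp c d).1], IsFloat p emin x :=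
    forall_mem_pair hF2.neg hhi2.neg
  have hee : IsWeakExpansion [(tp a b).2, (tp a b).1] := isWeakExpansion_pair_of_exact hfl2 h1 hs1
  have hff : IsWeakExpansion [-(tp c d).2, -(tp c d).1] :=
    isWeakExpansion_map_neg (l := [(tp c d).2, (tp c d).1]) (isWeakExpansion_pair_of_exact hfl2 h2 hs2)
  obtain ⟨hW, hS, hL, hF⟩ := expansionSum_isWeakExpansion hp hfl hfl2 he hf hee hff
  refine ⟨hW, ?_, hL, hF⟩
  show (expansionSum fl [(tp a b).2, (tp a b).1] [-(tp c d).2, -(tp c d).1]).sum = a * b - c * d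
  rw [hS]
  simp only [List.sum_cons, List.sum_nil]
  linarith

/-- **ERROR-FREE FMA TWO-PRODUCT ON A COARSE FORMAT**: for `x, y ∈ F(p, e₀)` with `2e₀ ≥ emin` the
product `xy = (Mx·My)·2^(ex+ey)` has `ex + ey ≥ emin`, so `2Prod_FMA` is exact
(`twoProdFMA_correct` [BoldoEtAl2023, §4.2.2]). -/
theorem exactTwoProd_twoProdFMA (hp : 1 ≤ p) (hfl : IsRoundNearest p emin fl) {e₀ : ℤ}
    (h2 : emin ≤ e₀ + e₀) {x y : ℚ} (hx : IsFloat p e₀ x) (hy : IsFloat p e₀ y) :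
    ExactTwoProd p emin fl (twoProdFMA fl) x y := by
  obtain ⟨Mx, ex, hMx, hex, rfl⟩ := hx
  obtain ⟨My, ey, hMy, hey, rfl⟩ := hy
  obtain ⟨-, hsum⟩ := twoProdFMA_correct hp hfl hMx hMy (by omega : emin ≤ ex + ey)
  exact ⟨rfl, hsum, (hfl _).1⟩

/-- **ERROR-FREE DEKKER TWO-PRODUCT ON A COARSE FORMAT** (Shewchuk's Theorem 18 with `s` satisfying
`p ≤ 2s ≤ p + 1`, `p ≥ 4`, rounding commuting with negation): on `F(p, e₀)²` the no-underflow
hypotheses of `twoProduct_spec` hold as soon as `e₀ ≥ emin + p − 1` and `2e₀ ≥ emin + 2p − 1`. -/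
theorem exactTwoProd_twoProduct (hp : 4 ≤ p) {s : ℕ} (hs2 : p ≤ 2 * s) (hs2' : 2 * s ≤ p + 1)
    (hfl : IsRoundNearest p emin fl) (hodd : ∀ t, fl (-t) = -fl t) {e₀ : ℤ}
    (h1 : emin + p - 1 ≤ e₀) (h2 : emin + 2 * p - 1 ≤ e₀ + e₀) {x y : ℚ} (hx : IsFloat p e₀ x)
    (hy : IsFloat p e₀ y) : ExactTwoProd p emin fl (twoProduct fl s) x y := by
  have hp1 : 1 ≤ p := le_trans (by norm_num) hp
  have he₀ : emin ≤ e₀ := by omega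
  have hxy : x * y = 0 ∨ ((2 : ℚ) ^ (emin + p - 1) ≤ |x| ∧ (2 : ℚ) ^ (emin + p - 1) ≤ |y| ∧
      (2 : ℚ) ^ (emin + 2 * p - 1) ≤ |x * y|) := by
    by_cases hx0 : x = 0
    · left; simp [hx0]
    by_cases hy0 : y = 0
    · left; simp [hy0]
    right
    have gx : (2 : ℚ) ^ e₀ ≤ |x| := (OnGrid.of_isFloat hx).two_zpow_le_abs hx0
    have gy : (2 : ℚ) ^ e₀ ≤ |y| := (OnGrid.of_isFloat hy).two_zpow_le_abs hy0
    have m1 : (2 : ℚ) ^ (emin + p - 1) ≤ (2 : ℚ) ^ e₀ := zpow_le_zpow_right₀ (by norm_num) h1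
    refine ⟨m1.trans gx, m1.trans gy, ?_⟩
    rw [abs_mul]
    calc (2 : ℚ) ^ (emin + 2 * p - 1) ≤ (2 : ℚ) ^ (e₀ + e₀) := zpow_le_zpow_right₀ (by norm_num) h2
      _ = (2 : ℚ) ^ e₀ * (2 : ℚ) ^ e₀ := zpow_add₀ (by norm_num) _ _
      _ ≤ |x| * |y| := mul_le_mul gx gy (zpow_nonneg (by norm_num) _) (abs_nonneg x)
  obtain ⟨hfst, hsum, hF, -, -⟩ := twoProduct_spec hp hs2 hs2' hfl hodd (roundoffBelow_one hp1 hfl)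
    (isFloat_of_emin_le he₀ hx) (isFloat_of_emin_le he₀ hy) hxy
  exact ⟨hfst, hsum, hF⟩

end Summit.Ventures.CertifiedArithmetic.Expansions
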